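import Summits.ValiantsHypothesis.ValiantsHypothesis.Theorems.SymmetroidDescartesDerivedPencilRolleStairCells

/-!
# Route SymmetroidDescartes — refutation of `DerivedPencilRolle` (stmt-ValiantsHypothesis-18500):
the staircase family — the margin law, the order of the test points, signs

THE LAW (H2) by induction on the level: in the core of a cell every non-canonical walk through
`𝒢_k(p)` costs at least `val + P_k hw_{k+1}` (`law_succ`: split the walk at the staircase; a deviating
first child pays with its own margin, which dominates the variation of the rest by (C2); otherwise the
decision lemma or the margin of the second child applies).  Then: the test parameters
`λ_j = α_L(j) + 2` increase with `j`, and the canonical walk of cell `j` has sign `(-1)^(j % n)` (only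
the top staircase carries signs).
-/

-- single-conjunct layout: Sub = Summit, duplicated namespace component intended
set_option linter.dupNamespace false

namespace Summit.ValiantsHypothesis.ValiantsHypothesis.Theorems.SymmetroidDescartes.DPR

open scoped BigOperators

section
variable (n L : ℕ)

/-- The law at level `0`: the empty gadget has only the empty walk. [folklore] -/
theorem law_zero : Law n L 0 := by
  intro p i j lam _ _ _ w hw
  cases w with
  | nil => exact absurd rfl hw
  | cons v w => simp [gad]

/-- `T_{k+1} = 2 T_k + n + 1` for the layer counts `T_k = (2^k − 1)(n+1)`. [folklore] -/
theorem layers_succ (k : ℕ) : (2 ^ (k + 1) - 1) * (n + 1) = 2 * ((2 ^ k - 1) * (n + 1)) + (n + 1) := by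
  have h : 1 ≤ 2 ^ k := Nat.one_le_two_pow
  zify [h, (by rw [pow_succ]; omega : 1 ≤ 2 ^ (k + 1))]
  rw [pow_succ]; ring

/-- INDUCTIVE STEP of the law. [folklore] -/
theorem law_succ (hn : 1 ≤ n) (k : ℕ) (hk : k + 1 ≤ L) (ih : Law n L k) : Law n L (k + 1) := by
  intro p i j lam hp hi hcore w hne
  -- names
  set P : ℕ := slopeP n L (k + 1) with hPdef
  set d : ℕ := j / n with hd
  set r : ℕ := j % n with hr
  set σ : ℕ := sig n k d with hσ
  set e : ℕ := i + σ with he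
  set A := gad n L k (p - P) with hAdef
  set J := stairJ n L (k + 1) p with hJdef
  set B := gad n L k P with hBdef
  set T : ℕ := (2 ^ k - 1) * (n + 1) with hT
  have hgad : gad n L (k + 1) p = A ++ (J ++ B) := rfl
  have hcanon : canon n L (k + 1) p i j = canon n L k (p - P) i d ++ (stairWalk n e r ++ canon n L k P (e + r) d) := rfl
  have hval : val n L (k + 1) p i j lam = val n L k (p - P) i d lam + fval n L k p e r d lam := rfl
  have hlenA : A.length = T := length_gad n L hn k _
  have hlenB : B.length = T := length_gad n L hn k _
  have hlenJ : J.length = n + 1 := length_stairJ n L _ _ hn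
  have hTk : (2 ^ (k + 1) - 1) * (n + 1) = 2 * T + (n + 1) := layers_succ n k
  have hrn : r + 1 ≤ n := Nat.mod_lt j hn
  have hσT : σ ≤ T := sig_le n hn k d
  -- the parameters of the children are admissible
  have hQ2 := two_le_bigQ n L
  have hPsucc : P = bigQ n L * slopeP n L (k + 2) := slopeP_succ n L (k + 1) hk
  have hpA : |p - (P : ℤ)| ≤ 2 * slopeP n L (k + 1) := by
    have h1 : |p - (P : ℤ)| ≤ |p| + P := by
      calc |p - (P : ℤ)| ≤ |p| + |(P : ℤ)| := abs_sub _ _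
        _ = |p| + P := by rw [Nat.abs_cast]
    have h2 : (2 * slopeP n L (k + 2) : ℤ) + P ≤ 2 * P := by
      have : 2 * slopeP n L (k + 2) ≤ P := by
        rw [hPsucc]; exact Nat.mul_le_mul_right _ hQ2
      have : ((2 * slopeP n L (k + 2) : ℕ) : ℤ) ≤ P := by exact_mod_cast this
      push_cast at this; linarith
    rw [← hPdef]; linarith
  have hpB : |(P : ℤ)| ≤ 2 * slopeP n L (k + 1) := by
    rw [abs_of_nonneg (by positivity), ← hPdef]; linarith
  have hcoreD : InCore n L k d lam := inCore_parent n L hn k hk j lam hcore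
  have hiA : i + (2 ^ k - 1) * (n + 1) ≤ Rtot n L := by rw [hTk] at hi; omega
  -- trivial if the cost is infinite
  by_cases htop : walkCost (expo n L) lam (gad n L (k + 1) p) (i, false) w = ⊤
  · rw [htop]; exact le_top
  rw [hgad] at htop ⊢
  obtain ⟨hlen1, hsplit1, hcost1⟩ := walkCost_append_split (expo n L) lam A (J ++ B) (i, false) w htop
  set w₁ := w.take A.length with hw₁
  set w₂₃ := w.drop A.length with hw₂₃
  set x₁ := walkLast (i, false) w₁ with hx₁
  rw [hcost1] at htop ⊢
  obtain ⟨hAtop, h23⟩ := WithTop.add_ne_top.1 htop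
  obtain ⟨hlen2, hsplit2, hcost2⟩ := walkCost_append_split (expo n L) lam J B x₁ w₂₃ h23
  set w₂ := w₂₃.take J.length with hw₂
  set w₃ := w₂₃.drop J.length with hw₃
  rw [hcost2] at h23 ⊢
  obtain ⟨hJtop, hBtop⟩ := WithTop.add_ne_top.1 h23
  -- the walk enters the staircase at the base, in row e' ∈ [i, i + T]
  set e' : ℕ := x₁.1 with he'
  have hx1 : x₁ = (e', false) := by
    ext
    · rfl
    · by_contra hb
      have hb' : x₁.2 = true := by simpa using hb
      have : x₁ = (e', true) := Prod.ext rfl hb'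
      rw [this, hJdef, stair_from_climb] at hJtop
      exact hJtop rfl
  have hrows := row_bounds_of_rowStep (expo n L) lam A (rowStep_gad n L k _) (i, false) w₁ hAtop
  rw [← hx₁, hlenA] at hrows
  have he'1 : i ≤ e' := hrows.1
  have he'2 : e' ≤ i + T := hrows.2
  -- structure of the staircase part
  rw [hx1] at hJtop hBtop ⊢
  obtain ⟨r', hr', hw₂eq, hcJ⟩ := stair_structure n L (k + 1) (by omega) hk p lam e' w₂ hJtop
  have hx2 : walkLast (e', false) w₂ = (e' + r', false) := by rw [hw₂eq, walkLast_stairWalk]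
  rw [hx2] at hBtop ⊢
  rw [hcJ]
  -- finite values of the three parts
  obtain ⟨a, ha⟩ := WithTop.ne_top_iff_exists.1 hAtop
  obtain ⟨b, hb⟩ := WithTop.ne_top_iff_exists.1 hBtop
  rw [← ha, ← hb]
  -- lower bounds from the induction hypothesis
  have hAval : val n L k (p - P) i d lam ≤ a ∧ (w₁ ≠ canon n L k (p - P) i d → val n L k (p - P) i d lam + gapZ n L k ≤ a) := by
    by_cases hc : w₁ = canon n L k (p - P) i d
    · have := walkCost_canon n L hn lam k (by omega) (p - P) i d
      rw [← hc, ← hAdef, ← ha] at this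
      have := WithTop.coe_eq_coe.1 this
      exact ⟨this.ge, fun h => absurd hc h⟩
    · have := ih (p - P) i d lam hpA hiA hcoreD w₁ hc
      rw [← hAdef, ← ha, WithTop.coe_le_coe] at this
      have hg : 0 ≤ gapZ n L k := by simp only [gapZ]; positivity
      exact ⟨by linarith, fun _ => this⟩
  have hiB : e' + r' + (2 ^ k - 1) * (n + 1) ≤ Rtot n L := by rw [hTk] at hi; omega
  have hBval : val n L k P (e' + r') d lam ≤ b ∧ (w₃ ≠ canon n L k P (e' + r') d → val n L k P (e' + r') d lam + gapZ n L k ≤ b) := by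
    by_cases hc : w₃ = canon n L k P (e' + r') d
    · have := walkCost_canon n L hn lam k (by omega) (P : ℤ) (e' + r') d
      rw [← hc, ← hBdef, ← hb] at this
      have := WithTop.coe_eq_coe.1 this
      exact ⟨this.ge, fun h => absurd hc h⟩
    · have := ih P (e' + r') d lam hpB hiB hcoreD w₃ hc
      rw [← hBdef, ← hb, WithTop.coe_le_coe] at this
      have hg : 0 ≤ gapZ n L k := by simp only [gapZ]; positivity
      exact ⟨by linarith, fun _ => this⟩
  -- the two numerical conditions
  have heR : e ≤ Rtot n L := by omega
  have hsmall := cond_small n L k hk p hp e heR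
  have hgapk : gapZ n L (k + 1) ≤ gapZ n L k := by
    have := cond_gap n L k hk 0 (Nat.zero_le _)
    simp only [gapZ, Nat.cast_zero, zero_mul, add_zero] at this ⊢
    exact this
  have hvar : fval n L k p e r' d lam ≤ fval n L k p e' r' d lam + gapZ n L k - gapZ n L (k + 1) := by
    have h1 := fval_var n L hn k (by omega) p e e' r' d T lam (by omega) (by omega) (by omega)
    have h2 := cond_gap n L k hk T (by rw [hT]; exact Nat.mul_le_mul_right _ (Nat.sub_le _ _))
    have h3 : (T : ℤ) * (|p| * (2 * hw n L (k + 1)) * n + slopeP n L (k + 1) * (2 * hw n L 0))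
        ≤ T * ((2 * slopeP n L (k + 2)) * (2 * hw n L (k + 1)) * n + slopeP n L (k + 1) * (2 * hw n L 0)) := by
      apply mul_le_mul_of_nonneg_left _ (by positivity)
      have : |p| * (2 * hw n L (k + 1)) * n ≤ (2 * slopeP n L (k + 2)) * (2 * hw n L (k + 1)) * n := by
        apply mul_le_mul_of_nonneg_right _ (by positivity)
        exact mul_le_mul_of_nonneg_right hp (by positivity)
      linarith
    simp only [gapZ]
    linarith
  have hdec : ∀ r'' : ℕ, fval n L k p e r d lam ≤ fval n L k p e r'' d lam := by
    intro r''
    by_cases h : r'' = r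
    · rw [h]
    · have := fval_gap n L hn k hk p e j r'' lam hcore hsmall (by rw [← hr]; exact h)
      rw [← hr, ← hd] at this
      have hg : 0 ≤ (slopeP n L (k + 1) : ℤ) * hw n L (k + 2) := by positivity
      linarith
  -- the goal as an integer inequality
  rw [← WithTop.coe_add, ← WithTop.coe_add, WithTop.coe_le_coe, hval]
  -- case analysis
  by_cases hc1 : w₁ = canon n L k (p - P) i d
  · -- the first child is canonical: the staircase is entered at row e
    have hee : e' = e := by
      have : x₁ = (e, false) := by rw [hx₁, hc1, walkLast_canon]
      rw [hx1] at this
      exact congrArg Prod.fst this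
    rw [hee] at hBval hw₂eq ⊢
    by_cases hrr : r' = r
    · -- same digit: then the second child must deviate
      rw [hrr] at hBval hw₂eq ⊢
      have hc3 : w₃ ≠ canon n L k P (e + r) d := by
        intro hc3
        apply hne
        rw [hcanon, hsplit1, hsplit2, hc1, hw₂eq, hc3]
      have := hBval.2 hc3
      simp only [fval] at *
      linarith [hAval.1]
    · have := fval_gap n L hn k hk p e j r' lam hcore hsmall (by rw [← hr]; exact hrr)
      rw [← hr, ← hd] at this
      simp only [fval, gapZ] at *
      linarith [hAval.1, hBval.1]
  · -- the first child deviates: its margin pays for everything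
    have h1 := hAval.2 hc1
    have h2 := hBval.1
    have h3 := hdec r'
    simp only [fval] at *
    linarith

/-- The law holds at every level `k ≤ L` (`n ≥ 1`). [folklore] -/
theorem law_all (hn : 1 ≤ n) : ∀ k, k ≤ L → Law n L k
  | 0, _ => law_zero n L
  | k + 1, hk => law_succ n L hn k hk (law_all hn k (by omega))

/-- `λ_j` lies in the core of the finest cell `j`. [folklore] -/
theorem inCore_lamOf (j : ℕ) : InCore n L L j (lamOf n L j) := by
  simp only [InCore, lamOf, hw, Nat.sub_self, pow_zero, Nat.cast_one, mul_one,
    show L + 1 - L = 1 by omega, pow_one]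
  push_cast
  constructor <;> nlinarith

/-- The cell locations increase with the cell number, by at least a cell width (`n ≥ 1`,
`k ≤ L`, cells `j < j' < n^k`). [folklore] -/
theorem loc_lt (hn : 1 ≤ n) : ∀ (k : ℕ), k ≤ L → ∀ (j j' : ℕ), j < j' → j' < n ^ k →
    loc n L k j + 2 * hw n L k ≤ loc n L k j'
  | 0, _, j, j', h1, h2 => by simp at h2; omega
  | k + 1, hk, j, j', h1, h2 => by
      rw [loc, loc]
      have hd' : j' / n < n ^ k := Nat.div_lt_of_lt_mul (by rw [← pow_succ']; exact h2)
      have hdd : j / n ≤ j' / n := Nat.div_le_div_right h1.le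
      have e1 := hw_succ n L k (by omega)
      have hr : j % n + 1 ≤ n := Nat.mod_lt j hn
      have hpos := hw_pos n L (k + 1)
      rcases hdd.lt_or_eq with hlt | heq
      · have ih := loc_lt hn k (by omega) (j / n) (j' / n) hlt hd'
        generalize j % n = r at hr ⊢
        have : 2 * hw n L (k + 1) * (1 + r) + 2 * hw n L (k + 1) ≤ 2 * hw n L k := by
          rw [e1]; nlinarith
        nlinarith [Nat.zero_le (2 * hw n L (k + 1) * (1 + j' % n))]
      · have hmod : j % n < j' % n := by
          have hj := Nat.div_add_mod j n
          have hj' := Nat.div_add_mod j' n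
          rw [heq] at hj
          omega
        rw [heq]
        nlinarith

/-- The test parameters are strictly increasing in the cell number (`j < j' < n^L`). [folklore] -/
theorem lamOf_lt (hn : 1 ≤ n) (j j' : ℕ) (h : j < j') (hj' : j' < n ^ L) : lamOf n L j < lamOf n L j' := by
  have := loc_lt n L hn L le_rfl j j' h hj'
  have hpos := hw_pos n L L
  simp only [lamOf]
  have : (loc n L L j : ℤ) + 2 * hw n L L ≤ loc n L L j' := by exact_mod_cast this
  have : (0 : ℤ) < hw n L L := by exact_mod_cast hpos
  linarith

/-- Through sign-free layers every walk has sign `1`. [folklore] -/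
theorem walkSign_negFree {K : ℕ} : ∀ (g : List (WLayer (ℕ × Bool) K)), (∀ l ∈ g, NegFree l) →
    ∀ (v : ℕ × Bool) (w : List (ℕ × Bool)), walkSign g v w = 1
  | [], _, v, w => walkSign_nil v w
  | _ :: _, _, _, [] => rfl
  | l :: g, hg, v, v' :: w => by
      rw [walkSign_cons_cons, walkSign_negFree g (fun l' hl' => hg l' (by simp [hl'])) v' w, mul_one]
      cases hv : l v v' with
      | none => rfl
      | some e =>
          have := hg l (by simp) v v' e hv
          simp [WEdge.sgn, this]

/-- Below the top level the staircases are sign-free. [folklore] -/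
theorem negFree_stairJ (k : ℕ) (hk : k ≠ L) (p : ℤ) : ∀ l ∈ stairJ n L k p, NegFree l := by
  intro l hl
  simp only [stairJ, List.mem_cons, List.mem_append, List.not_mem_nil, or_false] at hl
  rcases hl with rfl | hl | rfl
  · intro v v' e he
    simp only [entryLayer] at he
    split_ifs at he
    simp only [Option.some.injEq] at he
    rw [← he]; rfl
  · suffices ∀ m s0, l ∈ climbs n L k p s0 m → NegFree l from this _ _ hl
    intro m
    induction m with
    | zero => intro s0 h; simp at h
    | succ m ih =>
        intro s0 h
        rw [climbs_succ, List.mem_cons] at h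
        rcases h with rfl | h
        · intro v v' e he
          simp only [climbLayer] at he
          split_ifs at he <;> simp only [Option.some.injEq] at he <;> rw [← he]
          · simp [hk]
          · rfl
        · exact ih _ h
  · intro v v' e he
    simp only [exitLayer] at he
    split_ifs at he
    simp only [Option.some.injEq] at he
    rw [← he]; rfl

/-- Below the top level the gadgets are sign-free. [folklore] -/
theorem negFree_gad : ∀ (k : ℕ), k < L → ∀ (p : ℤ), ∀ l ∈ gad n L k p, NegFree l
  | 0, _, _ => by simp [gad]
  | k + 1, hk, p => by
      intro l hl
      rw [gad, List.mem_append, List.mem_append] at hl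
      rcases hl with hl | hl | hl
      · exact negFree_gad k (by omega) _ l hl
      · exact negFree_stairJ n L (k + 1) (by omega) p l hl
      · exact negFree_gad k (by omega) _ l hl

/-- Staying at the base has sign `1`. [folklore] -/
theorem walkSign_replicate_base (k : ℕ) (p : ℤ) :
    ∀ (m s ρ : ℕ), walkSign (climbs n L k p s m) (ρ, false) (List.replicate m (ρ, false)) = 1
  | 0, _, _ => rfl
  | m + 1, s, ρ => by
      rw [List.replicate_succ, climbs_succ, walkSign_cons_cons, walkSign_replicate_base k p m]
      simp [climbLayer, WEdge.sgn, flatE]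

/-- At the top level, climbing `r` times has sign `(-1)^r`. [folklore] -/
theorem walkSign_climbWalk_top (p : ℤ) : ∀ (m s ρ r : ℕ), r ≤ m →
    walkSign (climbs n L L p s m) (ρ, true) (climbWalk ρ m r) = (-1) ^ r
  | 0, s, ρ, r, hr => by
      have : r = 0 := by omega
      subst this; rfl
  | m + 1, s, ρ, 0, _ => by
      rw [climbWalk, climbWalk_zero, climbs_succ, walkSign_cons_cons, walkSign_replicate_base]
      simp [climbLayer, WEdge.sgn, flatE]
  | m + 1, s, ρ, r + 1, hr => by
      rw [climbWalk, climbs_succ, walkSign_cons_cons, walkSign_climbWalk_top p m (s + 1) (ρ + 1) r (by omega),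
        climbLayer_true, if_pos (by simp), pow_succ]
      simp [WEdge.sgn]

/-- The top staircase walk `stair(e, r)` has sign `(-1)^r` (`r ≤ n − 1`). [folklore] -/
theorem walkSign_stairWalk_top (p : ℤ) (e r : ℕ) (hr : r ≤ n - 1) :
    walkSign (stairJ n L L p) (e, false) (stairWalk n e r) = (-1) ^ r := by
  rw [stairJ, stairWalk, walkSign_cons_cons, walkSign_append _ _ (e, true) _ _ (by simp),
    walkSign_climbWalk_top n L p (n - 1) 0 e r hr]
  have h1 : entryLayer n L L p (e, false) (e, true) = some (flatE L (p * e * (2 * hw n L L))) := by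
    simp [entryLayer]
  have h3 : walkSign [exitLayer L] (walkLast (e, true) (climbWalk e (n - 1) r)) [(e + r, false)] = 1 := by
    rw [walkSign_cons_cons, walkSign_nil, mul_one]
    have : exitLayer L (walkLast (e, true) (climbWalk e (n - 1) r)) (e + r, false) = some (flatE L 0) := by
      simp [exitLayer, walkLast_climbWalk_fst e (n - 1) r true hr]
    rw [this]; rfl
  rw [h1, h3]
  simp [WEdge.sgn, flatE]

/-- The sign of the canonical walk of the full graph `𝒢_L(0)` in cell `j` is `(-1)^(j % n)`
(`L ≥ 1`, `n ≥ 1`). [folklore] -/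
theorem walkSign_canon_top (hn : 1 ≤ n) (hL : 1 ≤ L) (j : ℕ) :
    walkSign (gad n L L 0) (0, false) (canon n L L 0 0 j) = (-1) ^ (j % n) := by
  obtain ⟨K, rfl⟩ : ∃ K, L = K + 1 := ⟨L - 1, by omega⟩
  rw [gad, canon, walkSign_append _ _ _ _ _ (by rw [length_canon n _ hn, length_gad n _ hn]),
    walkSign_append _ _ _ _ _ (by rw [length_stairWalk n _ _ hn, length_stairJ n _ _ _ hn]),
    walkLast_canon, walkLast_stairWalk,
    walkSign_negFree _ (negFree_gad n (K + 1) K (by omega) _),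
    walkSign_negFree _ (negFree_gad n (K + 1) K (by omega) _),
    walkSign_stairWalk_top n (K + 1) 0 _ _ (by have := Nat.mod_lt j hn; omega)]
  ring

end

/-- Registered stub of this file: the law holds at every level. [folklore] -/
theorem stub_stairLaw : ∀ (n L : ℕ), 1 ≤ n → ∀ (k : ℕ), k ≤ L → Law n L k :=
  fun n L hn k hk => law_all n L hn k hk


end Summit.ValiantsHypothesis.ValiantsHypothesis.Theorems.SymmetroidDescartes.DPR
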